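import Summits.AtomisticToContinuum.Crystallization.Theorems.PricedLinkCensusStackingHingeIdealStarRigidity
import Summits.AtomisticToContinuum.Crystallization.Theorems.PricedLinkCensusStackingHingeHcpLocalExactRigid
import Summits.AtomisticToContinuum.Crystallization.Theorems.PricedLinkCensusStackingHingeBarlowShellSupport

/-!
# Route `PricedLinkCensus`, crux `StackingHinge` (stmt-AtomisticToContinuum-14993), line `Sketch`:
# exact-star rigidity off the ideal ratio, I — vocabulary and the relaxed reference star

Support file 1 of 4 for the registered stub `stub_relaxedStarRigidity` (pure geometry; the three
other files are `…RelaxedStarRigidityLocal`, `…RelaxedStarRigidityStretch` and the stub file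
`…RelaxedStarRigidity`).  This file holds the small vocabulary of the proof and its read-backs:

* the finite combinatorics of the twelve star labels `hcpStarIdx` (`starIdx_facts`, by `decide`:
  in-layer/polar dichotomy, no antipodal polar pairs, polar points over holes adjacent to an
  in-layer strut, adjacent independent in-layer struts, the triangle under a polar strut) and its
  metric read-backs through `hcpSite_dist_sq`: for `h ≠ a √(2/3)` the relaxed reference star
  `refStar a h` consists of six IN-LAYER struts of length `a` in the plane `x₂ = 0` and six POLAR
  struts of length `ρ = √(a²/3 + h²) ≠ a` at heights `± h` (`mem_refStar_cases`; on the parameter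
  box `ρ ≤ 5/4`, `rho_sq_le`, and `ρ ≠ a`, `rho_sq_ne`);
* `layerAxis = e₃`;
* `pball S x = {y | x + y ∈ S, y ≠ 0, ‖y‖ ≤ 5/4}`, the punctured `5/4`-ball of `S − x` (literally the
  set of the stub's hypothesis), and its transport under translations and rotations;
* `axialStretch g : (z₀, z₁, z₂) ↦ (z₀, z₁, g z₂)`, the linear stretch along `e₃`, which maps
  `refStar a c` onto `refStar a (g c)` and `barlowStacking a c s` onto `barlowStacking a (g c) s`;
* `starComp S`, the star-component of `0` in `S` (points reachable from `0` through punctured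
  `5/4`-balls), with its closure properties.

All `[folklore]`.
-/

noncomputable section

namespace Summit.AtomisticToContinuum.Crystallization.Theorems.PricedHcpWindowsRelaxedStarRigidity

open Literature.MathematicalPhysics.StatisticalMechanics Literature.Geometry.DiscreteGeometry
open Summit.AtomisticToContinuum.Crystallization.Theorems.PalmUnimodularRigidity.LayeredLawsSelectHcp
open Summit.AtomisticToContinuum.Crystallization.Theorems.PricedHcpWindowsIdealStarRigidity
open Summit.AtomisticToContinuum.Crystallization.Theorems.PricedHcpWindowsHcpLocalExactRigid
open Summit.AtomisticToContinuum.Crystallization.Theorems.PricedHcpWindowsBarlowShellSupport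

/-! ## The twelve labels: integer facts -/

/-- **The finite combinatorics of the twelve star labels** (by `decide`): (1) a label is in-layer
(`k = 0`, integer metric `(12, 0)` against the root) or polar (`k = ±1`, metric `(4, 1)`);
(2) no two labels are antipodal unless in-layer; (3) every in-layer label has a polar label at
metric `(4, 1)` (a polar point over an adjacent hole); (4) every in-layer label has an adjacent
in-layer label (metric `(12, 0)`) independent of it; (5) every polar label has two independent
in-layer labels at metric `(4, 1)` (the triangle under it). [folklore] -/
theorem starIdx_facts :
    (∀ v ∈ hcpStarIdx, (v.1 = 0 ∧ siteQ v 0 = (12, 0)) ∨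
      ((v.1 = 1 ∨ v.1 = -1) ∧ siteQ v 0 = (4, 1))) ∧
    (∀ v ∈ hcpStarIdx, ∀ w ∈ hcpStarIdx, siteInt v + siteInt w = 0 → v.1 = 0) ∧
    (∀ v ∈ hcpStarIdx, v.1 = 0 → ∃ w ∈ hcpStarIdx, siteQ w v = (4, 1)) ∧
    (∀ v ∈ hcpStarIdx, v.1 = 0 → ∃ w ∈ hcpStarIdx, w.1 = 0 ∧ siteQ w 0 = (12, 0) ∧
      siteQ w v = (12, 0) ∧ ((siteInt v).1 * (siteInt w).2.1 - (siteInt v).2.1 * (siteInt w).1) ≠ 0) ∧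
    (∀ v ∈ hcpStarIdx, v.1 ≠ 0 → ∃ w ∈ hcpStarIdx, ∃ w' ∈ hcpStarIdx, w.1 = 0 ∧ w'.1 = 0 ∧
      siteQ w 0 = (12, 0) ∧ siteQ w' 0 = (12, 0) ∧ siteQ w v = (4, 1) ∧ siteQ w' v = (4, 1) ∧
      ((siteInt w).1 * (siteInt w').2.1 - (siteInt w).2.1 * (siteInt w').1) ≠ 0) := by
  decide

/-! ## Metric read-backs -/

/-- Squared norm of a site in integer form: `‖y_v‖² = a²/12 · q₁ + h² · q₂`, `(q₁, q₂) = siteQ v 0`.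
[folklore] -/
theorem hcpSite_norm_sq_siteQ (a h : ℝ) (v : ℤ × ℤ × ℤ) :
    ‖hcpSite a h v‖ ^ 2 = a ^ 2 / 12 * (siteQ v 0).1 + h ^ 2 * (siteQ v 0).2 := by
  rw [← dist_zero_right, ← hcpSite_zero a h, hcpSite_dist_sq]

/-- A label at metric `(12, 0)` from the root is a strut of length `a`. [folklore] -/
theorem norm_hcpSite_of_siteQ_eq {a h : ℝ} (ha : 0 ≤ a) {v : ℤ × ℤ × ℤ}
    (hq : siteQ v 0 = (12, 0)) : ‖hcpSite a h v‖ = a := by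
  have h2 : ‖hcpSite a h v‖ ^ 2 = a ^ 2 := by
    rw [hcpSite_norm_sq_siteQ, hq]; push_cast; ring
  exact (pow_left_inj₀ (norm_nonneg _) ha two_ne_zero).1 h2

/-- A label at metric `(4, 1)` from the root is a strut of squared length `a²/3 + h²`. [folklore] -/
theorem norm_sq_hcpSite_of_siteQ_eq {a h : ℝ} {v : ℤ × ℤ × ℤ} (hq : siteQ v 0 = (4, 1)) :
    ‖hcpSite a h v‖ ^ 2 = a ^ 2 / 3 + h ^ 2 := by
  rw [hcpSite_norm_sq_siteQ, hq]; push_cast; ring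

/-- Two labels at metric `(12, 0)` are at distance `a`. [folklore] -/
theorem dist_hcpSite_of_siteQ_eq {a h : ℝ} (ha : 0 ≤ a) {v w : ℤ × ℤ × ℤ}
    (hq : siteQ w v = (12, 0)) : dist (hcpSite a h w) (hcpSite a h v) = a := by
  have h2 : dist (hcpSite a h w) (hcpSite a h v) ^ 2 = a ^ 2 := by
    rw [hcpSite_dist_sq, hq]; push_cast; ring
  exact (pow_left_inj₀ dist_nonneg ha two_ne_zero).1 h2

/-- Two labels at metric `(4, 1)` are at squared distance `a²/3 + h²`. [folklore] -/
theorem dist_sq_hcpSite_of_siteQ_eq {a h : ℝ} {v w : ℤ × ℤ × ℤ} (hq : siteQ w v = (4, 1)) :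
    dist (hcpSite a h w) (hcpSite a h v) ^ 2 = a ^ 2 / 3 + h ^ 2 := by
  rw [hcpSite_dist_sq, hq]; push_cast; ring

/-- The in-plane determinant of two sites in terms of their integer coordinates. [folklore] -/
theorem det_hcpSite (a h : ℝ) (v w : ℤ × ℤ × ℤ) :
    hcpSite a h v 0 * hcpSite a h w 1 - hcpSite a h v 1 * hcpSite a h w 0 =
      a ^ 2 * √3 / 12 * ((siteInt v).1 * (siteInt w).2.1 - (siteInt v).2.1 * (siteInt w).1) := by
  obtain ⟨e0, e1, -⟩ := siteVec_apply a h (siteInt v)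
  obtain ⟨f0, f1, -⟩ := siteVec_apply a h (siteInt w)
  rw [hcpSite_eq_siteVec, hcpSite_eq_siteVec, e0, e1, f0, f1]
  push_cast
  ring

/-- Sites with non-zero integer in-plane determinant are independent in the plane (`a ≠ 0`).
[folklore] -/
theorem det_hcpSite_ne_zero {a h : ℝ} (ha : a ≠ 0) {v w : ℤ × ℤ × ℤ}
    (hdet : ((siteInt v).1 * (siteInt w).2.1 - (siteInt v).2.1 * (siteInt w).1) ≠ 0) :
    hcpSite a h v 0 * hcpSite a h w 1 - hcpSite a h v 1 * hcpSite a h w 0 ≠ 0 := by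
  rw [det_hcpSite]
  have hd : (((siteInt v).1 * (siteInt w).2.1 - (siteInt v).2.1 * (siteInt w).1) : ℝ) ≠ 0 := by exact_mod_cast hdet
  have h3 : (√3 : ℝ) ≠ 0 := by positivity
  exact mul_ne_zero (by positivity) hd

/-- Membership in the reference star, unfolded. [folklore] -/
theorem mem_coe_refStar_iff {a h : ℝ} {y : EuclideanSpace ℝ (Fin 3)} :
    y ∈ (refStar a h : Set (EuclideanSpace ℝ (Fin 3))) ↔ ∃ v ∈ hcpStarIdx, hcpSite a h v = y := by
  rw [refStar, Finset.coe_image, Set.mem_image]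
  simp only [Finset.mem_coe]

/-- Sites of star labels are in the reference star. [folklore] -/
theorem hcpSite_mem_refStar {a h : ℝ} {v : ℤ × ℤ × ℤ} (hv : v ∈ hcpStarIdx) :
    hcpSite a h v ∈ (refStar a h : Set (EuclideanSpace ℝ (Fin 3))) :=
  mem_coe_refStar_iff.2 ⟨v, hv, rfl⟩

/-- **The two kinds of struts**: a point of `refStar a h` is in-layer (norm `a`, height `0`) or
polar (squared norm `a²/3 + h²`, height `± h`). [folklore] -/
theorem mem_refStar_cases {a h : ℝ} (ha : 0 ≤ a) {y : EuclideanSpace ℝ (Fin 3)}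
    (hy : y ∈ (refStar a h : Set (EuclideanSpace ℝ (Fin 3)))) :
    (‖y‖ = a ∧ y 2 = 0) ∨ (‖y‖ ^ 2 = a ^ 2 / 3 + h ^ 2 ∧ (y 2 = h ∨ y 2 = -h)) := by
  obtain ⟨v, hv, rfl⟩ := mem_coe_refStar_iff.1 hy
  rcases starIdx_facts.1 v hv with ⟨hk, hq⟩ | ⟨hk, hq⟩
  · exact Or.inl ⟨norm_hcpSite_of_siteQ_eq ha hq, by rw [hcpSite_apply_two, hk]; simp⟩
  · refine Or.inr ⟨norm_sq_hcpSite_of_siteQ_eq hq, ?_⟩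
    rcases hk with hk | hk
    · left; rw [hcpSite_apply_two, hk]; simp
    · right; rw [hcpSite_apply_two, hk]; simp

/-- Off the ideal ratio, a strut of length `a` is in-layer. [folklore] -/
theorem apply_two_eq_zero_of_norm_eq {a h : ℝ} (ha : 0 ≤ a) (hρ : a ^ 2 / 3 + h ^ 2 ≠ a ^ 2)
    {y : EuclideanSpace ℝ (Fin 3)} (hy : y ∈ (refStar a h : Set (EuclideanSpace ℝ (Fin 3))))
    (hn : ‖y‖ = a) : y 2 = 0 := by
  rcases mem_refStar_cases ha hy with ⟨-, h0⟩ | ⟨hsq, -⟩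
  · exact h0
  · exact absurd (by rw [← hsq, hn]) hρ

/-- Off the ideal ratio, a strut of length `≠ a` is polar. [folklore] -/
theorem apply_two_of_norm_ne {a h : ℝ} (ha : 0 ≤ a)
    {y : EuclideanSpace ℝ (Fin 3)} (hy : y ∈ (refStar a h : Set (EuclideanSpace ℝ (Fin 3))))
    (hn : ‖y‖ ≠ a) : ‖y‖ ^ 2 = a ^ 2 / 3 + h ^ 2 ∧ (y 2 = h ∨ y 2 = -h) := by
  rcases mem_refStar_cases ha hy with ⟨h0, -⟩ | h2
  · exact absurd h0 hn
  · exact h2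

/-! ## Box numerics -/

section Box

variable {a h : ℝ} (ha₁ : 189 / 200 ≤ a) (ha₂ : a ≤ 199 / 200) (hh₁ : 77 / 100 ≤ h)
  (hh₂ : h ≤ 163 / 200)
include ha₁ ha₂ hh₁ hh₂

/-- On the box the polar strut is shorter than `5/4`: `a²/3 + h² ≤ (5/4)²`. [folklore] -/
theorem rho_sq_le : a ^ 2 / 3 + h ^ 2 ≤ (5 / 4) ^ 2 := by nlinarith

omit ha₂ hh₂ in
/-- Off the ideal ratio the polar strut is not of length `a`: `a²/3 + h² ≠ a²`. [folklore] -/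
theorem rho_sq_ne (hne : h ≠ a * Real.sqrt (2 / 3)) : a ^ 2 / 3 + h ^ 2 ≠ a ^ 2 := by
  intro heq
  apply hne
  have hh : 0 ≤ h := by linarith
  have ha : 0 ≤ a * Real.sqrt (2 / 3) := by positivity
  have h2 : h ^ 2 = (a * Real.sqrt (2 / 3)) ^ 2 := by
    rw [mul_pow, Real.sq_sqrt (by norm_num : (0 : ℝ) ≤ 2 / 3)]; linarith
  exact (pow_left_inj₀ hh ha two_ne_zero).1 h2

end Box

/-- A distance of square `a²/3 + h²` on the box is positive and at most `5/4`. [folklore] -/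
theorem dist_bounds_of_sq_eq {a h d : ℝ} (hd : 0 ≤ d) (hle : a ^ 2 / 3 + h ^ 2 ≤ (5 / 4) ^ 2)
    (hh : 0 < h) (hsq : d ^ 2 = a ^ 2 / 3 + h ^ 2) : 0 < d ∧ d ≤ 5 / 4 := by
  refine ⟨?_, le_of_pow_le_pow_left₀ two_ne_zero (by norm_num) (hsq ▸ hle)⟩
  rcases hd.lt_or_eq with hd | hd
  · exact hd
  · rw [← hd] at hsq; nlinarith

/-! ## The layer normal -/

/-- The unit layer normal `e₃ = (0, 0, 1)`. [folklore] -/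
def layerAxis : EuclideanSpace ℝ (Fin 3) := EuclideanSpace.single 2 1

/-- Coordinates of `e₃`. [folklore] -/
theorem layerAxis_apply : layerAxis 0 = 0 ∧ layerAxis 1 = 0 ∧ layerAxis 2 = 1 := by
  refine ⟨?_, ?_, ?_⟩ <;> simp [layerAxis]

/-- `⟪e₃, z⟫ = z₂`. [folklore] -/
theorem inner_layerAxis_left (z : EuclideanSpace ℝ (Fin 3)) : inner ℝ layerAxis z = z 2 := by
  rw [layerAxis, EuclideanSpace.inner_single_left]; simp

/-! ## Punctured `5/4`-balls and their transport -/

/-- The punctured `5/4`-ball of `S − x`: `{y | x + y ∈ S, y ≠ 0, ‖y‖ ≤ 5/4}` (literally the set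
of the stub's hypothesis). [folklore] -/
def pball (S : Set (EuclideanSpace ℝ (Fin 3))) (x : EuclideanSpace ℝ (Fin 3)) :
    Set (EuclideanSpace ℝ (Fin 3)) :=
  {y | y ∈ ((fun p : EuclideanSpace ℝ (Fin 3) => p - x) '' S) ∧ y ≠ 0 ∧ ‖y‖ ≤ 5 / 4}

/-- Membership in the punctured ball. [folklore] -/
theorem mem_pball_iff {S : Set (EuclideanSpace ℝ (Fin 3))} {x y : EuclideanSpace ℝ (Fin 3)} :
    y ∈ pball S x ↔ x + y ∈ S ∧ y ≠ 0 ∧ ‖y‖ ≤ 5 / 4 := by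
  simp only [pball, Set.mem_setOf_eq, mem_translate_iff]

/-- A point `z ∈ S` near `x` gives the element `z - x` of the punctured ball. [folklore] -/
theorem sub_mem_pball {S : Set (EuclideanSpace ℝ (Fin 3))} {x z : EuclideanSpace ℝ (Fin 3)}
    (hz : z ∈ S) (hne : z ≠ x) (hd : dist z x ≤ 5 / 4) : z - x ∈ pball S x :=
  mem_pball_iff.2 ⟨by rwa [add_sub_cancel], sub_ne_zero.2 hne, by rwa [← dist_eq_norm]⟩

/-- Punctured balls of a translate. [folklore] -/
theorem pball_translate (S : Set (EuclideanSpace ℝ (Fin 3))) (x y : EuclideanSpace ℝ (Fin 3)) :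
    pball ((fun p : EuclideanSpace ℝ (Fin 3) => p - x) '' S) (y - x) = pball S y := by
  ext z
  simp only [mem_pball_iff, mem_translate_iff]
  rw [show x + (y - x + z) = y + z by abel]

/-- Punctured balls of a rotated set. [folklore] -/
theorem pball_image (A : EuclideanSpace ℝ (Fin 3) ≃ₗᵢ[ℝ] EuclideanSpace ℝ (Fin 3))
    (S : Set (EuclideanSpace ℝ (Fin 3))) (x : EuclideanSpace ℝ (Fin 3)) :
    pball (A '' S) (A x) = A '' pball S x := by
  ext z
  constructor
  · intro hz
    rw [mem_pball_iff] at hz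
    obtain ⟨⟨q, hq, hqe⟩, hz0, hzn⟩ := hz
    refine ⟨A.symm z, mem_pball_iff.2 ⟨?_, by simpa using hz0, by rwa [LinearIsometryEquiv.norm_map]⟩,
      A.apply_symm_apply z⟩
    have : q = x + A.symm z := by
      apply A.injective
      rw [map_add, A.apply_symm_apply, hqe]
    rwa [← this]
  · rintro ⟨q, hq, rfl⟩
    rw [mem_pball_iff] at hq ⊢
    obtain ⟨hq, hq0, hqn⟩ := hq
    exact ⟨⟨x + q, hq, by rw [map_add]⟩, by simpa using hq0, by rwa [LinearIsometryEquiv.norm_map]⟩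

/-- **Normalisation at a centre**: for `x ∈ S` and a rotation `A`, the set
`S' = A⁻¹ (S − x)` contains `0`, and its punctured balls are the rotated punctured balls of `S`:
`pball S' (A⁻¹ (y − x)) = A⁻¹ '' pball S y`. [folklore] -/
theorem normalize_at {S : Set (EuclideanSpace ℝ (Fin 3))} {x : EuclideanSpace ℝ (Fin 3)}
    (hx : x ∈ S) (A : EuclideanSpace ℝ (Fin 3) ≃ₗᵢ[ℝ] EuclideanSpace ℝ (Fin 3)) :
    (0 : EuclideanSpace ℝ (Fin 3)) ∈ A.symm '' ((fun p : EuclideanSpace ℝ (Fin 3) => p - x) '' S) ∧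
    ∀ y : EuclideanSpace ℝ (Fin 3),
      pball (A.symm '' ((fun p : EuclideanSpace ℝ (Fin 3) => p - x) '' S)) (A.symm (y - x)) =
        A.symm '' pball S y := by
  refine ⟨⟨x - x, ⟨x, hx, rfl⟩, by rw [sub_self, map_zero]⟩, fun y => ?_⟩
  rw [pball_image, pball_translate]

/-- Points of a rotated scaled FCC pattern have norm `a`. [folklore] -/
theorem norm_of_mem_image_fcc {a : ℝ} (ha : 0 ≤ a)
    (B : EuclideanSpace ℝ (Fin 3) ≃ₗᵢ[ℝ] EuclideanSpace ℝ (Fin 3)) {y : EuclideanSpace ℝ (Fin 3)}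
    (hy : y ∈ B '' ((fun p : EuclideanSpace ℝ (Fin 3) => a • p) ''
      (fccKissingPattern : Set (EuclideanSpace ℝ (Fin 3))))) : ‖y‖ = a := by
  obtain ⟨_, ⟨q, hq, rfl⟩, rfl⟩ := hy
  rw [LinearIsometryEquiv.norm_map, norm_smul, Real.norm_of_nonneg ha,
    norm_eq_one_of_mem_fccKissingPattern hq, mul_one]

/-! ## The stretch along `e₃` -/

/-- The linear stretch by `g` along the layer normal: `(z₀, z₁, z₂) ↦ (z₀, z₁, g z₂)`. [folklore] -/
def axialStretch (g : ℝ) (z : EuclideanSpace ℝ (Fin 3)) : EuclideanSpace ℝ (Fin 3) :=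
  !₂[z 0, z 1, g * z 2]

/-- Coordinates of the stretch. [folklore] -/
theorem axialStretch_apply (g : ℝ) (z : EuclideanSpace ℝ (Fin 3)) :
    axialStretch g z 0 = z 0 ∧ axialStretch g z 1 = z 1 ∧ axialStretch g z 2 = g * z 2 := by
  simp [axialStretch]

/-- Stretches compose multiplicatively. [folklore] -/
theorem axialStretch_comp (g g' : ℝ) (z : EuclideanSpace ℝ (Fin 3)) :
    axialStretch g (axialStretch g' z) = axialStretch (g * g') z := by
  ext i; fin_cases i <;> simp [axialStretch]; ring

/-- The unit stretch is the identity. [folklore] -/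
theorem axialStretch_one (z : EuclideanSpace ℝ (Fin 3)) : axialStretch 1 z = z := by
  ext i; fin_cases i <;> simp [axialStretch]

/-- The stretch is additive. [folklore] -/
theorem axialStretch_add (g : ℝ) (z z' : EuclideanSpace ℝ (Fin 3)) :
    axialStretch g (z + z') = axialStretch g z + axialStretch g z' := by
  ext i; fin_cases i <;> simp [axialStretch]; ring

/-- The stretch respects differences. [folklore] -/
theorem axialStretch_sub (g : ℝ) (z z' : EuclideanSpace ℝ (Fin 3)) :
    axialStretch g (z - z') = axialStretch g z - axialStretch g z' := by
  ext i; fin_cases i <;> simp [axialStretch]; ring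

/-- The stretch fixes the origin. [folklore] -/
theorem axialStretch_zero (g : ℝ) : axialStretch g (0 : EuclideanSpace ℝ (Fin 3)) = 0 := by
  ext i; fin_cases i <;> simp [axialStretch]

/-- Squared norm of a stretched vector. [folklore] -/
theorem norm_axialStretch_sq (g : ℝ) (z : EuclideanSpace ℝ (Fin 3)) :
    ‖axialStretch g z‖ ^ 2 = z 0 ^ 2 + z 1 ^ 2 + g ^ 2 * z 2 ^ 2 := by
  rw [norm_sq_eq_three]
  simp [axialStretch]
  ring

/-- The stretch of a stacking point is the stacking point with stretched layer spacing.
[folklore] -/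
theorem axialStretch_barlowPos (g a c : ℝ) (s : ℤ → ℤ) (k i j : ℤ) :
    axialStretch g (barlowPos a c s k i j) = barlowPos a (g * c) s k i j := by
  ext l
  fin_cases l <;> simp [axialStretch, barlowPos_apply_zero, barlowPos_apply_one, barlowPos_apply_two]
  ring

/-- **The stretch of a Barlow stacking** is the Barlow stacking with stretched layer spacing.
[folklore] -/
theorem axialStretch_image_barlowStacking (g a c : ℝ) (s : ℤ → ℤ) :
    axialStretch g '' barlowStacking a c s = barlowStacking a (g * c) s := by
  ext z
  constructor
  · rintro ⟨_, ⟨k, i, j, rfl⟩, rfl⟩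
    exact ⟨k, i, j, axialStretch_barlowPos g a c s k i j⟩
  · rintro ⟨k, i, j, rfl⟩
    exact ⟨_, ⟨k, i, j, rfl⟩, axialStretch_barlowPos g a c s k i j⟩

/-- The stretch of an hcp site. [folklore] -/
theorem axialStretch_hcpSite (g a c : ℝ) (v : ℤ × ℤ × ℤ) :
    axialStretch g (hcpSite a c v) = hcpSite a (g * c) v :=
  axialStretch_barlowPos g a c alternatingHagg v.1 v.2.1 v.2.2

/-- **The stretch of the reference star** is the reference star with stretched layer spacing.
[folklore] -/
theorem axialStretch_image_refStar (g a c : ℝ) :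
    axialStretch g '' (refStar a c : Set (EuclideanSpace ℝ (Fin 3))) =
      (refStar a (g * c) : Set (EuclideanSpace ℝ (Fin 3))) := by
  rw [refStar, refStar, Finset.coe_image, Finset.coe_image, Set.image_image]
  exact Set.image_congr' fun v => axialStretch_hcpSite g a c v

/-! ## The star-component of the origin -/

/-- **The star-component of `0` in `S`**: the points reachable from `0` by steps `p → q` with
`p ∈ S` and `q − p` in the punctured `5/4`-ball of `S − p`. [folklore] -/
def starComp (S : Set (EuclideanSpace ℝ (Fin 3))) : Set (EuclideanSpace ℝ (Fin 3)) :=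
  {z | Relation.ReflTransGen
    (fun p q : EuclideanSpace ℝ (Fin 3) => p ∈ S ∧ q - p ∈ pball S p) 0 z}

/-- The origin is in its star-component. [folklore] -/
theorem zero_mem_starComp (S : Set (EuclideanSpace ℝ (Fin 3))) : (0 : EuclideanSpace ℝ (Fin 3)) ∈ starComp S :=
  Relation.ReflTransGen.refl

/-- The star-component is closed under steps. [folklore] -/
theorem mem_starComp_of_step {S : Set (EuclideanSpace ℝ (Fin 3))} {p q : EuclideanSpace ℝ (Fin 3)}
    (hp : p ∈ starComp S) (hpS : p ∈ S) (hq : q - p ∈ pball S p) : q ∈ starComp S :=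
  Relation.ReflTransGen.tail hp ⟨hpS, hq⟩

/-- The endpoint of a step lies in `S`. [folklore] -/
theorem mem_of_step {S : Set (EuclideanSpace ℝ (Fin 3))} {p q : EuclideanSpace ℝ (Fin 3)}
    (hq : q - p ∈ pball S p) : q ∈ S := by
  have := (mem_pball_iff.1 hq).1
  rwa [add_sub_cancel] at this

/-- The star-component of `0 ∈ S` is contained in `S`. [folklore] -/
theorem starComp_subset {S : Set (EuclideanSpace ℝ (Fin 3))} (h0 : (0 : EuclideanSpace ℝ (Fin 3)) ∈ S) :
    starComp S ⊆ S := by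
  intro z hz
  induction hz with
  | refl => exact h0
  | tail _ hpq _ => exact mem_of_step hpq.2

/-- Steps are symmetric. [folklore] -/
theorem step_symm {S : Set (EuclideanSpace ℝ (Fin 3))} {p q : EuclideanSpace ℝ (Fin 3)} (hp : p ∈ S)
    (hq : q - p ∈ pball S p) : p - q ∈ pball S q := by
  obtain ⟨-, hne, hle⟩ := mem_pball_iff.1 hq
  refine sub_mem_pball hp (fun h => hne (by rw [h, sub_self])) ?_
  rwa [dist_eq_norm, ← norm_neg, neg_sub]

/-! ## Registered sub-goal -/

/-- **Registered sub-goal `stub_relaxedStarStruts` of stmt-AtomisticToContinuum-14993 (anchor of this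
support file): the two kinds of struts of the relaxed reference star** — a point of `refStar a h`
(`a ≥ 0`) is in-layer, of norm `a` and height `0`, or polar, of squared norm `a²/3 + h²` and height
`± h`. [folklore] -/
theorem stub_relaxedStarStruts : ∀ a h : ℝ, 0 ≤ a → ∀ y ∈ (↑(Summit.AtomisticToContinuum.Crystallization.Theorems.PalmUnimodularRigidity.LayeredLawsSelectHcp.refStar a h) : Set (EuclideanSpace ℝ (Fin 3))), (‖y‖ = a ∧ y 2 = 0) ∨ (‖y‖ ^ 2 = a ^ 2 / 3 + h ^ 2 ∧ (y 2 = h ∨ y 2 = -h)) := by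
  intro a h ha y hy
  exact mem_refStar_cases ha hy

end Summit.AtomisticToContinuum.Crystallization.Theorems.PricedHcpWindowsRelaxedStarRigidity

end
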